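import Literature.NumberTheory.ModularForms.LevelOneEisensteinCongruenceCuspForm
import Literature.NumberTheory.ModularForms.LevelOneHeckeEigencharacterModN
import Literature.NumberTheory.ModularForms.LevelOneHeckeEigenvalueLifting
import HarnessLib

/-!
# Ramanujan-type congruences in every weight: an eigenform `φ ≡ G_k` modulo each prime dividing the numerator of
# `B_k/2k` (Datskovsky–Guerzhoy, Thm. 2), and the Eisenstein character of `𝕋_ℤ`

B. Datskovsky, P. Guerzhoy, *On Ramanujan congruences for modular forms of integral and half-integral weights*,
Proc. Amer. Math. Soc. **124** (1996), p. 2285, verbatim: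

> "Now let `dim S_k ≥ 2`. We call a cusp form primitive if it is a common eigenfunction of all Hecke operators,
> normalized so that its first Fourier coefficient is equal to `1`. The coefficients of primitive forms are algebraic
> integers in some algebraic number field `K`. The following theorem is a higher weight analogue of Corollary 1.1:
> **Theorem 2.** Let `t = dim S_k`, and let `φ_1, …, φ_t` be the primitive Hecke eigenforms in `S_k`. Let `K` be an
> algebraic number field containing the Fourier coefficients of `φ_1, …, φ_t`, and let `P` be a prime ideal of `O_K`
> that divides `N_k`. Then there exists a primitive Hecke eigenform `φ_i` in `S_k` such that `φ_i ≡ G_k mod P`.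
> This theorem follows easily from Theorem 1 and Lemma 6.11 of [Deligne–Serre]."

(`G_k = −B_k/2k + Σσ_{k−1}(n)qⁿ`, `N_k` = numerator of `B_k/2k`; "`≡ mod P`": all Fourier coefficients of the
difference lie in `P·O_P` — for the coefficients of index `n ≥ 1`, which are in `O_K`, this is `a_n(φ_i) − σ_{k−1}(n)
∈ P`; the constant terms are `0` and `−B_k/2k`, whose difference lies in `P·O_P` exactly because `P ∣ N_k`.)

Everything is PROVED, by the route the authors indicate ("Theorem 1 and Lemma 6.11"): Theorem 1's cusp form in its
integral avatar `g ∈ S_k(ℤ)` (`exists_integral_cuspForm_congr_eisensteinG`, file `LevelOneEisensteinCongruenceCuspForm`)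
is a Hecke eigenvector modulo `N_k` with eigenvalues `σ_{k−1}(n)` and unit first coefficient, hence defines
(file `LevelOneHeckeEigencharacterModN`, Deligne–Serre's `χ`) the **Eisenstein character**
`θ_k : 𝕋_ℤ → ℤ/N_k`, `T(n) ↦ σ_{k−1}(n)`; composing with `ℤ/N_k → 𝓞_K/P` (`P ∋ N_k`) and applying the split
Deligne–Serre lifting (file `LevelOneHeckeEigenvalueLifting`, Lemme 6.11) yields the eigenform. (DG's own text proves
Thm. 2 by the elimination Lemma 2.1 instead of quoting 6.11; the statement formalized is theirs verbatim.)

## Contents (one definition with body + theorems; no named fact)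

* §1 ★`exists_isHeckeEigenvectorMod_sigma` (Thm. 1's `g` is a Hecke eigenvector mod `N_k` with unit `a₁`),
  ★**`eisensteinCharacter hk hk2 : levelOneHeckeRing k →+* ZMod (eisensteinNumerator k)`** (the Eisenstein character
  `θ_k`), ★`eisensteinCharacter_heckeTCuspₗ` (`θ_k(T(n)) = σ_{k−1}(n)`), `eisensteinCharacter_unique`,
  `eisensteinCharacter_surjective`, `heckeTCuspₗ_sub_sigma_mem_ker_eisensteinCharacter` (the Eisenstein ideal
  `(T(n) − σ_{k−1}(n))_n ⊆ ker θ_k`), `ker_eisensteinCharacter_ne_top` (proper when `N_k ≠ 1`).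
* §2 ★**`exists_eigenform_congr_eisensteinG`** — DG Theorem 2 as printed (any field `K` with `e : K → ℂ` containing
  the coefficients of all normalized eigenforms, any prime `P` of `𝓞 K` with `N_k ∈ P`), with the constant-term
  bookkeeping `intCast_num_bernoulliRatio_mem`.
* §3 corollaries over the ring `Z̄ = integralClosure ℤ ℂ` of all algebraic integers (no choice of `K`):
  ★`exists_eigenform_congr_eisensteinG_integralClosure` (every prime `P` of `Z̄` with `N_k ∈ P`),
  `exists_ideal_isPrime_natCast_mem_integralClosure` (every rational prime lies under a prime of `Z̄`), and
  ★**`exists_eigenform_congr_sigma_of_prime_dvd`** (for every prime `ℓ ∣ N_k` there are a normalized eigenform `f`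
  and a prime `P ∋ ℓ` of `Z̄` with `a_n(f) ≡ σ_{k−1}(n) (mod P)` for all `n ≥ 1`).

## References

* [DatskovskyGuerzhoy1996] B. Datskovsky, P. Guerzhoy, Proc. AMS 124 (1996) 2283–2291: Thm. 2 (p. 2285), Lemma 2.1
  and the proof of Thm. 2 (p. 2286).
* [DeligneSerreASENS1974] P. Deligne, J.-P. Serre, Ann. Sci. ÉNS (4) 7 (1974), Lemme 6.11 (p. 522).
* [Serre1973] J.-P. Serre, *A Course in Arithmetic*, GTM 7, Ch. VII §4.5 (57) (`τ(n) ≡ σ₁₁(n) (mod 691)`), §5.5.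
-/

noncomputable section

open scoped MatrixGroups ModularForm NumberField
open UpperHalfPlane hiding I
open ArithmeticFunction (sigma sigma_one)

namespace Literature.NumberTheory.ModularForms

variable {k : ℕ}

/-! ## §1 The Eisenstein character `θ_k : 𝕋_ℤ → ℤ/N_k` -/

section EisensteinCharacter

/-- ★ **Theorem 1's cusp form is a Hecke eigenvector modulo `N_k` with the Eisenstein eigenvalues and unit first
coefficient**: there are `g ∈ S_k(ℤ)` and `a ∈ ℤ` with `T(n)g − σ_{k−1}(n)g ∈ N_k·S_k(ℤ)` for all `n ≥ 1`, `a₁(g) = a`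
and `(a, N_k) = 1` (indeed `a ≡ D_k`). [cite: DatskovskyGuerzhoy1996, Thm. 1 and Lemma 2.1 (hypothesis (1) with
`β₀ ≢ 0`)] -/
theorem exists_isHeckeEigenvectorMod_sigma (hk : 3 ≤ k) (hk2 : Even k) :
    ∃ g : CuspForm 𝒮ℒ k, ∃ a : ℤ,
      IsHeckeEigenvectorMod (eisensteinNumerator k) g (fun n => (sigma (k - 1) n : ℤ)) ∧
        (a : ℂ) = (qExpansion 1 ⇑g).coeff 1 ∧ IsCoprime a (eisensteinNumerator k : ℤ) := by
  obtain ⟨g, hgmem, hgcoeff, hgT⟩ := exists_integral_cuspForm_congr_eisensteinG hk hk2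
  obtain ⟨a, ha, hadvd⟩ := hgcoeff 1 one_pos
  refine ⟨g, a, ⟨hgmem, fun n hn => ?_⟩, ha, ?_⟩
  · obtain ⟨r, hr, hTr⟩ := hgT n hn
    exact ⟨r, hr, by rw [Int.cast_natCast]; exact hTr⟩
  · -- `a = D_k + N_k t` and `(D_k, N_k) = 1`
    obtain ⟨t, ht⟩ := hadvd
    rw [sigma_one, Nat.cast_one, mul_one] at ht
    have ha' : a = (eisensteinDenominator k : ℤ) + (eisensteinNumerator k : ℤ) * t := by linarith
    rw [ha']
    exact (Nat.isCoprime_iff_coprime.mpr (eisensteinNumerator_coprime_eisensteinDenominator k).symm).add_mul_left_left t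

/-- ★ **The Eisenstein character `θ_k : 𝕋_ℤ → ℤ/N_k`, `T(n) ↦ σ_{k−1}(n) mod N_k`** (`k ≥ 4` even): the character of
the level-one Hecke ring `𝕋_ℤ(S_k(SL₂(ℤ)))` defined by the mod-`N_k` eigenvector `g ≡ G_k` of Theorem 1 (Deligne–Serre's
`χ : ℋ → k`, for the ideal `(N_k)`). Its kernel contains the Eisenstein ideal `(T(n) − σ_{k−1}(n) : n ≥ 1)`.
[cite: DatskovskyGuerzhoy1996, Thm. 2 (proof) and Lemma 2.1] [cite: DeligneSerreASENS1974, Lemme 6.11 (proof, `χ`)] -/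
def eisensteinCharacter (hk : 3 ≤ k) (hk2 : Even k) :
    levelOneHeckeRing (k : ℤ) →+* ZMod (eisensteinNumerator k) :=
  (exists_isHeckeEigenvectorMod_sigma hk hk2).choose_spec.choose_spec.1.character
    (exists_isHeckeEigenvectorMod_sigma hk hk2).choose_spec.choose_spec.2.1
    (exists_isHeckeEigenvectorMod_sigma hk hk2).choose_spec.choose_spec.2.2

/-- ★ **`θ_k(T(n)) = σ_{k−1}(n) mod N_k`** for every `n ≥ 1`. [cite: DatskovskyGuerzhoy1996, Thm. 2 / Lemma 2.1
("`σ_{k−1}(n) ≡ α₁(n) mod P`")] -/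
theorem eisensteinCharacter_heckeTCuspₗ (hk : 3 ≤ k) (hk2 : Even k) {n : ℕ} (hn : 0 < n) :
    eisensteinCharacter hk hk2 ⟨heckeTCuspₗ hn, heckeTCuspₗ_mem_levelOneHeckeRing hn⟩ =
      (sigma (k - 1) n : ZMod (eisensteinNumerator k)) := by
  rw [eisensteinCharacter, IsHeckeEigenvectorMod.character_heckeTCuspₗ, Int.cast_natCast]

/-- `θ_k(m) = m`. [cite: DatskovskyGuerzhoy1996, Thm. 2 (proof)] -/
theorem eisensteinCharacter_intCast (hk : 3 ≤ k) (hk2 : Even k) (m : ℤ) :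
    eisensteinCharacter hk hk2 (m : levelOneHeckeRing (k : ℤ)) = m :=
  map_intCast _ m

/-- **Uniqueness**: `θ_k` is the only ring homomorphism `𝕋_ℤ → ℤ/N_k` with `T(n) ↦ σ_{k−1}(n)` (the `T(n)` generate
`𝕋_ℤ`). [cite: DatskovskyGuerzhoy1996, Thm. 2 (proof)] [cite: DeligneSerreASENS1974, Lemme 6.11] -/
theorem eisensteinCharacter_unique (hk : 3 ≤ k) (hk2 : Even k)
    {ψ : levelOneHeckeRing (k : ℤ) →+* ZMod (eisensteinNumerator k)}
    (hψ : ∀ (n : ℕ) (hn : 0 < n), ψ ⟨heckeTCuspₗ hn, heckeTCuspₗ_mem_levelOneHeckeRing hn⟩ =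
      (sigma (k - 1) n : ZMod (eisensteinNumerator k))) :
    ψ = eisensteinCharacter hk hk2 :=
  IsHeckeEigenvectorMod.ringHom_ext_heckeTCuspₗ fun n hn => by rw [hψ n hn, eisensteinCharacter_heckeTCuspₗ]

/-- `θ_k` is surjective. [cite: DeligneSerreASENS1974, Lemme 6.11 (proof)] -/
theorem eisensteinCharacter_surjective (hk : 3 ≤ k) (hk2 : Even k) :
    Function.Surjective (eisensteinCharacter hk hk2) :=
  ZMod.ringHom_surjective _

/-- **The Eisenstein ideal is killed by `θ_k`**: `T(n) − σ_{k−1}(n) ∈ ker θ_k` for every `n ≥ 1`.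
[cite: DatskovskyGuerzhoy1996, Thm. 2 (proof)] [cite: DeligneSerreASENS1974, Lemme 6.11 (proof, `Ker(χ)`)] -/
theorem heckeTCuspₗ_sub_sigma_mem_ker_eisensteinCharacter (hk : 3 ≤ k) (hk2 : Even k) {n : ℕ} (hn : 0 < n) :
    (⟨heckeTCuspₗ hn, heckeTCuspₗ_mem_levelOneHeckeRing hn⟩ - ((sigma (k - 1) n : ℕ) : levelOneHeckeRing (k : ℤ)) :
      levelOneHeckeRing (k : ℤ)) ∈ RingHom.ker (eisensteinCharacter hk hk2) := by
  rw [RingHom.mem_ker, map_sub, eisensteinCharacter_heckeTCuspₗ, map_natCast, sub_self]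

/-- The Eisenstein ideal `(T(n) − σ_{k−1}(n) : n ≥ 1) ⊆ ker θ_k`. [cite: DatskovskyGuerzhoy1996, Thm. 2 (proof)] -/
theorem span_heckeTCuspₗ_sub_sigma_le_ker (hk : 3 ≤ k) (hk2 : Even k) :
    Ideal.span (Set.range fun n : ℕ+ =>
      (⟨heckeTCuspₗ n.pos, heckeTCuspₗ_mem_levelOneHeckeRing n.pos⟩ -
        ((sigma (k - 1) n : ℕ) : levelOneHeckeRing (k : ℤ)) : levelOneHeckeRing (k : ℤ))) ≤
      RingHom.ker (eisensteinCharacter hk hk2) := by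
  rw [Ideal.span_le]
  rintro _ ⟨n, rfl⟩
  exact heckeTCuspₗ_sub_sigma_mem_ker_eisensteinCharacter hk hk2 n.pos

/-- **`ker θ_k` is a proper ideal of `𝕋_ℤ` when `N_k ≠ 1`** (so every prime `ℓ ∣ N_k` gives a maximal ideal
`(ℓ, T(n) − σ_{k−1}(n))` of `𝕋_ℤ` — an "Eisenstein maximal ideal"). [cite: DatskovskyGuerzhoy1996, Thm. 2]
[cite: DeligneSerreASENS1974, Lemme 6.11 (proof, "l'idéal maximal `Ker(χ)`")] -/
theorem ker_eisensteinCharacter_ne_top (hk : 3 ≤ k) (hk2 : Even k) (hN : eisensteinNumerator k ≠ 1) :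
    RingHom.ker (eisensteinCharacter hk hk2) ≠ ⊤ := by
  haveI : Nontrivial (ZMod (eisensteinNumerator k)) := ZMod.nontrivial_iff.mpr hN
  exact RingHom.ker_ne_top _

end EisensteinCharacter

/-! ## §2 Theorem 2: `φ_i ≡ G_k mod P` -/

section TheoremTwo

/-- The coefficients `a_n(f)`, `n ≥ 1`, of a normalized eigenform which lie in `e(K)` lie in `e(𝓞_K)` ("The
coefficients of primitive forms are algebraic integers in some algebraic number field `K`").
[cite: DatskovskyGuerzhoy1996, §1 (before Thm. 2)] -/
theorem coeff_mem_range_ringOfIntegers {K : Type*} [Field K] (e : K →+* ℂ) {f : CuspForm 𝒮ℒ (k : ℤ)}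
    (hf : IsNormalizedCuspEigenform f) (hK : ∀ n, (qExpansion 1 ⇑f).coeff n ∈ e.range) {n : ℕ} (hn : 0 < n) :
    (qExpansion 1 ⇑f).coeff n ∈ (e.comp (algebraMap (𝓞 K) K)).range := by
  obtain ⟨x, hx⟩ := hK n
  have hint : IsIntegral ℤ x := by
    refine (isIntegral_algHom_iff e.toIntAlgHom e.injective).mp ?_
    change IsIntegral ℤ (e x)
    rw [hx]
    exact hf.isIntegral_coeff (by exact_mod_cast hn)
  obtain ⟨y, hy⟩ := (IsIntegralClosure.isIntegral_iff (A := 𝓞 K)).mp hint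
  exact ⟨y, by rw [RingHom.comp_apply, hy, hx]⟩

/-- The constant terms: `a₀(φ) = 0` and `a₀(G_k) = −B_k/2k = −s_k/D_k` with `s_k = ±N_k`, so their difference lies in
`P·O_P` for every prime `P ∋ N_k` (`D_k ∉ P` being prime to `N_k`); recorded as: the signed numerator `s_k` lies in
`P`. [cite: DatskovskyGuerzhoy1996, §1 Definition and Thm. 2] -/
theorem intCast_num_bernoulliRatio_mem {R : Type*} [CommRing R] {P : Ideal R}
    (hP : ((eisensteinNumerator k : ℕ) : R) ∈ P) : (((bernoulliRatio k).num : ℤ) : R) ∈ P := by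
  have h : (bernoulliRatio k).num = (bernoulliRatio k).num.sign * (eisensteinNumerator k : ℤ) := by
    rw [eisensteinNumerator, Int.sign_mul_natAbs]
  rw [h, Int.cast_mul, Int.cast_natCast]
  exact P.mul_mem_left _ hP

/-- ★ **Datskovsky–Guerzhoy, Theorem 2.** Let `k ≥ 4` be even, `K` a field with an embedding `e : K → ℂ` containing
the Fourier coefficients of all normalized ("primitive") eigenforms of `S_k(SL₂(ℤ))` (DG: an algebraic number
field), and `P` a prime ideal of `𝓞_K` dividing `N_k` (`N_k ∈ P`). Then there is a normalized eigenform `φ` with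
`φ ≡ G_k mod P`: for every `n ≥ 1`, `a_n(φ) = e(x_n)` with `x_n ∈ 𝓞_K` and `x_n − σ_{k−1}(n) ∈ P` (the constant terms
are handled by `intCast_num_bernoulliRatio_mem`). [cite: DatskovskyGuerzhoy1996, Thm. 2]
[cite: DeligneSerreASENS1974, Lemme 6.11] -/
theorem exists_eigenform_congr_eisensteinG (hk : 3 ≤ k) (hk2 : Even k) {K : Type*} [Field K] (e : K →+* ℂ)
    (hK : ∀ f : CuspForm 𝒮ℒ (k : ℤ), IsNormalizedCuspEigenform f → ∀ n, (qExpansion 1 ⇑f).coeff n ∈ e.range)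
    (P : Ideal (𝓞 K)) [P.IsPrime] (hP : ((eisensteinNumerator k : ℕ) : 𝓞 K) ∈ P) :
    ∃ f : CuspForm 𝒮ℒ (k : ℤ), IsNormalizedCuspEigenform f ∧ ∀ (n : ℕ), 0 < n →
      ∃ x : 𝓞 K, e (algebraMap (𝓞 K) K x) = (qExpansion 1 ⇑f).coeff n ∧ x - (sigma (k - 1) n : 𝓞 K) ∈ P := by
  -- `R = 𝓞 K`, `ẽ = e ∘ (𝓞 K → K)`
  set eR : 𝓞 K →+* ℂ := e.comp (algebraMap (𝓞 K) K) with heR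
  have hinj : Function.Injective eR := e.injective.comp NumberField.RingOfIntegers.coe_injective
  have hR : ∀ f : CuspForm 𝒮ℒ (k : ℤ), IsNormalizedCuspEigenform f → ∀ n, 0 < n →
      (qExpansion 1 ⇑f).coeff n ∈ eR.range := fun f hf n hn => coeff_mem_range_ringOfIntegers e hf (hK f hf) hn
  -- `θ = (ℤ/N_k → 𝓞 K/P) ∘ θ_k`
  have hchar : ringChar (𝓞 K ⧸ P) ∣ eisensteinNumerator k := by
    rw [← ringChar.spec, ← map_natCast (Ideal.Quotient.mk P), Ideal.Quotient.eq_zero_iff_mem]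
    exact hP
  set θ : levelOneHeckeRing (k : ℤ) →+* 𝓞 K ⧸ P :=
    (ZMod.castHom hchar (𝓞 K ⧸ P)).comp (eisensteinCharacter hk hk2) with hθ
  obtain ⟨f, hf, hcong⟩ := exists_eigenform_coeff_congr eR hinj hR P θ
  refine ⟨f, hf, fun n hn => ?_⟩
  obtain ⟨x, hx, hxP⟩ := hcong n hn
  refine ⟨x, hx, ?_⟩
  rw [← Ideal.Quotient.eq_zero_iff_mem, map_sub, hxP, hθ, RingHom.comp_apply, eisensteinCharacter_heckeTCuspₗ,
    map_natCast, map_natCast, sub_self]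

end TheoremTwo

/-! ## §3 Corollaries over the ring `Z̄ ⊆ ℂ` of all algebraic integers -/

section IntegralClosure

/-- Every coefficient of a normalized eigenform lies in `ℂ = id(ℂ)`: the hypothesis of Theorem 2 for `K = ℂ`.
[cite: DatskovskyGuerzhoy1996, Thm. 2] -/
theorem coeff_mem_range_id (f : CuspForm 𝒮ℒ (k : ℤ)) (n : ℕ) :
    (qExpansion 1 ⇑f).coeff n ∈ (RingHom.id ℂ).range :=
  ⟨_, rfl⟩

/-- ★ **Theorem 2 over `Z̄`.** For every prime ideal `P` of the ring `𝓞 ℂ = Z̄` of all algebraic integers in `ℂ` with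
`N_k ∈ P` there is a normalized eigenform `φ ∈ S_k(SL₂(ℤ))` with `a_n(φ) − σ_{k−1}(n) ∈ P` for all `n ≥ 1`
(`a_n(φ) ∈ Z̄`). [cite: DatskovskyGuerzhoy1996, Thm. 2] -/
theorem exists_eigenform_congr_eisensteinG_integralClosure (hk : 3 ≤ k) (hk2 : Even k)
    (P : Ideal (𝓞 ℂ)) [P.IsPrime] (hP : ((eisensteinNumerator k : ℕ) : 𝓞 ℂ) ∈ P) :
    ∃ f : CuspForm 𝒮ℒ (k : ℤ), IsNormalizedCuspEigenform f ∧ ∀ (n : ℕ), 0 < n →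
      ∃ x : 𝓞 ℂ, algebraMap (𝓞 ℂ) ℂ x = (qExpansion 1 ⇑f).coeff n ∧ x - (sigma (k - 1) n : 𝓞 ℂ) ∈ P := by
  obtain ⟨f, hf, h⟩ := exists_eigenform_congr_eisensteinG hk hk2 (RingHom.id ℂ)
    (fun f _ n => coeff_mem_range_id f n) P hP
  exact ⟨f, hf, fun n hn => by simpa only [RingHom.id_apply] using h n hn⟩

/-- A rational prime `ℓ` is not a unit in `Z̄` (`1/ℓ` is not an algebraic integer), so it lies in some prime (indeed
maximal) ideal of `Z̄`. [cite: DatskovskyGuerzhoy1996, Thm. 2 ("let `P` be a prime ideal of `O_K` that divides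
`N_k`")] -/
theorem exists_ideal_isPrime_natCast_mem_integralClosure {ℓ : ℕ} (hℓ : ℓ.Prime) :
    ∃ P : Ideal (𝓞 ℂ), P.IsPrime ∧ ((ℓ : ℕ) : 𝓞 ℂ) ∈ P := by
  have hne : Ideal.span {((ℓ : ℕ) : 𝓞 ℂ)} ≠ ⊤ := by
    intro htop
    rw [Ideal.span_singleton_eq_top] at htop
    obtain ⟨u, hu⟩ := htop
    -- `u⁻¹ = 1/ℓ` would be an algebraic integer
    have hinv : IsIntegral ℤ ((ℓ : ℂ)⁻¹) := by
      have h1 : ((u⁻¹ : (𝓞 ℂ)ˣ) : 𝓞 ℂ) * (ℓ : 𝓞 ℂ) = 1 := by rw [← hu, Units.inv_mul]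
      have h2 : algebraMap (𝓞 ℂ) ℂ ((u⁻¹ : (𝓞 ℂ)ˣ) : 𝓞 ℂ) = ((ℓ : ℂ))⁻¹ := by
        have h3 := congrArg (algebraMap (𝓞 ℂ) ℂ) h1
        rw [map_mul, map_natCast, map_one] at h3
        have hℓ0 : (ℓ : ℂ) ≠ 0 := by exact_mod_cast hℓ.ne_zero
        exact (eq_inv_of_mul_eq_one_left h3)
      rw [← h2]
      exact (NumberField.RingOfIntegers.isIntegral_coe _)
    -- a rational algebraic integer is an integer: `1/ℓ ∈ ℤ`, impossible
    have hrat : IsIntegral ℤ ((ℓ : ℚ)⁻¹) := by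
      refine (isIntegral_algebraMap_iff (B := ℂ) (algebraMap ℚ ℂ).injective).mp ?_
      rw [map_inv₀, map_natCast]
      exact hinv
    obtain ⟨m, hm⟩ := IsIntegrallyClosed.isIntegral_iff.mp hrat
    rw [eq_intCast] at hm
    have hℓ1 : (1 : ℚ) < ℓ := by exact_mod_cast hℓ.one_lt
    have hpos : (0 : ℚ) < (ℓ : ℚ)⁻¹ := inv_pos.mpr (by linarith)
    have hlt : (ℓ : ℚ)⁻¹ < 1 := inv_lt_one_of_one_lt₀ hℓ1
    rw [← hm] at hpos hlt
    have h0 : (0 : ℤ) < m := by exact_mod_cast hpos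
    have h1 : m < 1 := by exact_mod_cast hlt
    omega
  obtain ⟨M, hM, hle⟩ := Ideal.exists_le_maximal _ hne
  exact ⟨M, hM.isPrime, hle (Ideal.mem_span_singleton_self _)⟩

/-- ★ **Ramanujan-type congruence for every prime `ℓ ∣ N_k`.** For `k ≥ 4` even and a prime `ℓ` dividing the
numerator of `B_k/2k` there are a normalized eigenform `φ ∈ S_k(SL₂(ℤ))` and a prime ideal `P ∋ ℓ` of the ring `Z̄`
of algebraic integers with **`a_n(φ) ≡ σ_{k−1}(n) (mod P)` for all `n ≥ 1`** — e.g. `k = 12`, `ℓ = 691`: Ramanujan's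
congruence; `k = 16, …, 26`: Manin's; `k = 24`: `ℓ ∈ {103, 2294797}` (DG p. 2286). [cite: DatskovskyGuerzhoy1996,
Thm. 2 and Cor. 1.1] [cite: Serre1973, Ch. VII §4.5 (57)] -/
theorem exists_eigenform_congr_sigma_of_prime_dvd (hk : 3 ≤ k) (hk2 : Even k) {ℓ : ℕ} (hℓ : ℓ.Prime)
    (hdvd : ℓ ∣ eisensteinNumerator k) :
    ∃ f : CuspForm 𝒮ℒ (k : ℤ), IsNormalizedCuspEigenform f ∧ ∃ P : Ideal (𝓞 ℂ), P.IsPrime ∧ ((ℓ : ℕ) : 𝓞 ℂ) ∈ P ∧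
      ∀ (n : ℕ), 0 < n →
        ∃ x : 𝓞 ℂ, algebraMap (𝓞 ℂ) ℂ x = (qExpansion 1 ⇑f).coeff n ∧ x - (sigma (k - 1) n : 𝓞 ℂ) ∈ P := by
  obtain ⟨P, hP, hℓP⟩ := exists_ideal_isPrime_natCast_mem_integralClosure hℓ
  haveI := hP
  have hNP : ((eisensteinNumerator k : ℕ) : 𝓞 ℂ) ∈ P := by
    obtain ⟨c, hc⟩ := hdvd
    rw [hc, Nat.cast_mul]
    exact P.mul_mem_right _ hℓP
  obtain ⟨f, hf, h⟩ := exists_eigenform_congr_eisensteinG_integralClosure hk hk2 P hNP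
  exact ⟨f, hf, P, hP, hℓP, h⟩

end IntegralClosure

end Literature.NumberTheory.ModularForms
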